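/-
Copyright (c) 2026. Released under the Apache 2.0 license.
-/
import Literature.NumberTheory.EllipticCurves.PeriodLatticeGamma1QuotientProofs
import Literature.NumberTheory.EllipticCurves.ModularSymbolsPeriodHomology
import HarnessLib

/-!
# The Shimura quotient is Eisenstein: `(a_ℓ − ℓ − 1) Λ₀(f) ⊆ Λ₁(f)` for every prime `ℓ ∤ N`

[Proofs] Theorems only (no definition, no named fact). Topic `Literature/NumberTheory/EllipticCurves`;
namespace `Literature.NumberTheory.EllipticCurves.ModularForms`.  Companion of `ShimuraSubgroupHeckeCongruence.lean`
(THEOREM W: `(a_p − p)Λ₀(f) ⊆ Λ₁(f)` for `p ∣ N`) AWAY from the level.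

The source. K. Ribet, *On the component groups and the Shimura subgroup of J₀(N)*, Sém. Th. Nombres Bordeaux (1987–88),
exp. 6, Thm. 1 and §3 (bib key `Ribet1988Shimura`): the Shimura subgroup `Σ(N) = ker(J₀(N) → J₁(N))` is EISENSTEIN —
`T_ℓ` acts on it as `1 + ℓ` for every prime `ℓ ∤ N`; S. Ling, J. Oesterlé, *The Shimura subgroup of J₀(N)*, Astérisque
196–197 (1991), §1 and Thm. 1 (bib key `LingOesterle1991`).  Read on the period lattices of ONE form `f ∈ S₂(Γ₀(N))` with
`T_ℓ f = a f` (`Λ₀(f) ⊇ Λ₁(f)`, Shimura quotient `Λ₀/Λ₁` dual to `E₀ ∩ Σ(N)` for an elliptic optimal quotient):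

* `sub_sub_mul_cuspSymbol_mem_periodLatticeGamma1_of_not_dvd` — `(a − ℓ − 1)·{∞, γ∞}_f ∈ Λ₁(f)` for every `γ ∈ Γ₀(N)`,
  `ℓ ∤ N` prime;
* `heckeEigenPeriodCongruence_of_not_dvd` — `(a − ℓ − 1) Λ₀(f) ⊆ Λ₁(f)`;
* `sub_sub_mul_mem_periodLatticeGamma1_of_isNewform0` — for a newform, `(a_ℓ(f) − ℓ − 1) Λ₀(f) ⊆ Λ₁(f)`.

Proof (Manin symbols, Cremona §2.4): `a·{∞, γ∞}_f = {∞, γ∞}_{T_ℓ f} = ∑_{j mod ℓ} {∞, (γ∞ + j)/ℓ}_f + {∞, ℓ·γ∞}_f`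
(tree `modularSymbol_heckeT_eq_sum`); each cusp on the right is `δ∞` for an explicit `δ ∈ Γ₀(N)` (`Gamma0.mkOfCol`) whose class
in `Γ₀(N)/Γ₁(N) = (ℤ/N)ˣ` is that of `γ` — except, when `ℓ ∤ c_γ`, for the one `j₀` with `ℓ ∣ a_γ + j₀c_γ` (class of `γ`
times `ℓ`) and for the last cusp (class of `γ` times `ℓ⁻¹`), whose deviations `±{∞, γ_ℓ∞}_f` cancel modulo `Λ₁(f)` (Manin's
homomorphism `cuspSymbol_mul` and `cuspSymbol_sub_mem_periodLatticeGamma1_of_apply_eq`).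

## References
* [Ribet1988Shimura] K. A. Ribet, Sém. Théorie des Nombres de Bordeaux 1987–88, exposé 6, Thm. 1, §3.
* [LingOesterle1991] S. Ling, J. Oesterlé, Astérisque 196–197 (1991), §1 and Thm. 1.
* [CremonaAlgorithms1997] J. E. Cremona, *Algorithms for modular elliptic curves*, §2.4 (2.4.1)–(2.4.2).
* [Manin1972] Ju. I. Manin, Izv. 6 (1972), Prop. 1.4, Thm. 1.6.
-/

noncomputable section

open scoped MatrixGroups ModularForm

open CongruenceSubgroup

namespace Literature.NumberTheory.EllipticCurves.ModularForms

variable {N : ℕ} [NeZero N]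

/-! ### `Γ₀(N)/Γ₁(N)`-classes via the top-left entry -/

omit [NeZero N] in
/-- For `γ ∈ Γ₀(N)`: `a_γ d_γ ≡ 1 (mod N)` (`det γ = 1`, `c_γ ≡ 0`). [cite: DiamondShurman2005, §1.2] -/
theorem apply_zero_zero_mul_apply_one_one (γ : Gamma0 N) :
    ((((γ : SL(2, ℤ)) 0 0 : ℤ) : ZMod N)) * (((γ : SL(2, ℤ)) 1 1 : ℤ) : ZMod N) = 1 := by
  have hdet : ((γ : SL(2, ℤ)) 0 0 : ℤ) * (γ : SL(2, ℤ)) 1 1 - (γ : SL(2, ℤ)) 0 1 * (γ : SL(2, ℤ)) 1 0 = 1 := by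
    have h := Matrix.SpecialLinearGroup.det_coe (γ : SL(2, ℤ))
    rw [Matrix.det_fin_two] at h
    exact h
  have hc : ((((γ : SL(2, ℤ)) 1 0 : ℤ) : ZMod N)) = 0 :=
    (ZMod.intCast_zmod_eq_zero_iff_dvd _ N).mpr (dvd_entry_of_mem_Gamma0 N γ.2)
  have h := congrArg (fun x : ℤ ↦ (x : ZMod N)) hdet
  simp only [Int.cast_sub, Int.cast_mul, Int.cast_one, hc, mul_zero, sub_zero] at h
  exact h

omit [NeZero N] in
/-- The lower-right entry of a product in `Γ₀(N)` is the product of the lower-right entries modulo `N`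
(`γ ↦ d_γ mod N` is the homomorphism `Gamma0Map`). [cite: DiamondShurman2005, §1.2] -/
theorem apply_one_one_mul_eq (γ δ : Gamma0 N) :
    ((((γ * δ : Gamma0 N) : SL(2, ℤ)) 1 1 : ℤ) : ZMod N) =
      (((γ : SL(2, ℤ)) 1 1 : ℤ) : ZMod N) * (((δ : SL(2, ℤ)) 1 1 : ℤ) : ZMod N) := by
  have h := map_mul (Gamma0Map N) γ δ
  exact h

variable (f : CuspForm (Gamma0 N) 2)

/-- `{∞, δ∞}_f ≡ {∞, γ∞}_f (mod Λ₁(f))` when `a_δ ≡ a_γ (mod N)` (then `d_δ ≡ d_γ`). [cite: Stevens1989, §2] -/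
theorem cuspSymbol_sub_mem_periodLatticeGamma1_of_apply_zero_zero_eq (γ δ : Gamma0 N)
    (ha : (((δ : SL(2, ℤ)) 0 0 : ℤ) : ZMod N) = (((γ : SL(2, ℤ)) 0 0 : ℤ) : ZMod N)) :
    cuspSymbol f δ - cuspSymbol f γ ∈ periodLatticeGamma1 f := by
  refine cuspSymbol_sub_mem_periodLatticeGamma1_of_apply_eq f γ δ ?_
  have hγ := apply_zero_zero_mul_apply_one_one γ
  have hδ := apply_zero_zero_mul_apply_one_one δ
  rw [ha] at hδ
  calc (((γ : SL(2, ℤ)) 1 1 : ℤ) : ZMod N)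
      = (((γ : SL(2, ℤ)) 1 1 : ℤ) : ZMod N) * ((((γ : SL(2, ℤ)) 0 0 : ℤ) : ZMod N) *
          (((δ : SL(2, ℤ)) 1 1 : ℤ) : ZMod N)) := by rw [hδ, mul_one]
    _ = ((((γ : SL(2, ℤ)) 0 0 : ℤ) : ZMod N) * (((γ : SL(2, ℤ)) 1 1 : ℤ) : ZMod N)) *
          (((δ : SL(2, ℤ)) 1 1 : ℤ) : ZMod N) := by ring
    _ = _ := by rw [hγ, one_mul]

/-- `{∞, δ∞}_f ≡ {∞, γ∞}_f + {∞, κ∞}_f (mod Λ₁(f))` when `ℓ·a_δ ≡ a_γ (mod N)` and `d_κ ≡ ℓ` (then `d_δ ≡ d_γ d_κ`).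
[cite: Stevens1989, §2] [cite: Manin1972, Prop. 1.4] -/
theorem cuspSymbol_sub_sub_mem_periodLatticeGamma1_of_mul_apply_zero_zero_eq (γ δ κ : Gamma0 N) {ℓ : ZMod N}
    (hκ : (((κ : SL(2, ℤ)) 1 1 : ℤ) : ZMod N) = ℓ)
    (ha : ℓ * (((δ : SL(2, ℤ)) 0 0 : ℤ) : ZMod N) = (((γ : SL(2, ℤ)) 0 0 : ℤ) : ZMod N)) :
    cuspSymbol f δ - cuspSymbol f γ - cuspSymbol f κ ∈ periodLatticeGamma1 f := by
  have h := cuspSymbol_sub_mem_periodLatticeGamma1_of_apply_eq f (γ * κ) δ ?_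
  · rw [cuspSymbol_mul_holds f γ κ] at h
    convert h using 1
    ring
  · rw [apply_one_one_mul_eq, hκ]
    have hγ := apply_zero_zero_mul_apply_one_one γ
    have hδ := apply_zero_zero_mul_apply_one_one δ
    -- `d_δ = d_δ (a_γ d_γ) = d_δ (ℓ a_δ) d_γ = ℓ d_γ (a_δ d_δ) = ℓ d_γ`
    calc (((γ : SL(2, ℤ)) 1 1 : ℤ) : ZMod N) * ℓ
        = (((γ : SL(2, ℤ)) 1 1 : ℤ) : ZMod N) * ℓ *
            ((((δ : SL(2, ℤ)) 0 0 : ℤ) : ZMod N) * (((δ : SL(2, ℤ)) 1 1 : ℤ) : ZMod N)) := by rw [hδ, mul_one]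
      _ = (ℓ * (((δ : SL(2, ℤ)) 0 0 : ℤ) : ZMod N)) * (((γ : SL(2, ℤ)) 1 1 : ℤ) : ZMod N) *
            (((δ : SL(2, ℤ)) 1 1 : ℤ) : ZMod N) := by ring
      _ = (((δ : SL(2, ℤ)) 1 1 : ℤ) : ZMod N) := by rw [ha, hγ, one_mul]

/-- `{∞, δ∞}_f ≡ {∞, γ∞}_f − {∞, κ∞}_f (mod Λ₁(f))` when `a_δ ≡ ℓ·a_γ (mod N)` and `d_κ ≡ ℓ` (then `d_δ d_κ ≡ d_γ`).
[cite: Stevens1989, §2] [cite: Manin1972, Prop. 1.4] -/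
theorem cuspSymbol_sub_add_mem_periodLatticeGamma1_of_apply_zero_zero_eq_mul (γ δ κ : Gamma0 N) {ℓ : ZMod N}
    (hκ : (((κ : SL(2, ℤ)) 1 1 : ℤ) : ZMod N) = ℓ)
    (ha : (((δ : SL(2, ℤ)) 0 0 : ℤ) : ZMod N) = ℓ * (((γ : SL(2, ℤ)) 0 0 : ℤ) : ZMod N)) :
    cuspSymbol f δ - cuspSymbol f γ + cuspSymbol f κ ∈ periodLatticeGamma1 f := by
  have h := cuspSymbol_sub_mem_periodLatticeGamma1_of_apply_eq f γ (δ * κ) ?_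
  · rw [cuspSymbol_mul_holds f δ κ] at h
    convert h using 1
    ring
  · rw [apply_one_one_mul_eq, hκ]
    have hγ := apply_zero_zero_mul_apply_one_one γ
    have hδ := apply_zero_zero_mul_apply_one_one δ
    rw [ha] at hδ
    -- `d_γ = d_γ (ℓ a_γ d_δ) = (a_γ d_γ) (d_δ ℓ) = d_δ ℓ`
    calc (((γ : SL(2, ℤ)) 1 1 : ℤ) : ZMod N)
        = (((γ : SL(2, ℤ)) 1 1 : ℤ) : ZMod N) *
            (ℓ * (((γ : SL(2, ℤ)) 0 0 : ℤ) : ZMod N) * (((δ : SL(2, ℤ)) 1 1 : ℤ) : ZMod N)) := by rw [hδ, mul_one]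
      _ = ((((γ : SL(2, ℤ)) 0 0 : ℤ) : ZMod N) * (((γ : SL(2, ℤ)) 1 1 : ℤ) : ZMod N)) *
            ((((δ : SL(2, ℤ)) 1 1 : ℤ) : ZMod N) * ℓ) := by ring
      _ = (((δ : SL(2, ℤ)) 1 1 : ℤ) : ZMod N) * ℓ := by rw [hγ, one_mul]

/-! ### The Hecke cusps `(γ∞ + j)/ℓ` and `ℓ·γ∞` as `Γ₀(N)`-translates of `∞`, with their classes -/

omit [NeZero N] f in
/-- **The cusp `(1 j; 0 ℓ)γ∞ = (γ∞ + j)/ℓ` with its `Γ₀(N)/Γ₁(N)`-class.**  For `γ = (a b; c d) ∈ Γ₀(N)`, `ℓ` prime and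
`j ∈ ℤ` there is `δ ∈ Γ₀(N)` with `δ∞ = (a + jc)/(ℓc)` whose top-left entry is `a + jc ≡ a (mod N)` if `ℓ ∤ a + jc`, and
`u` with `ℓu = a + jc ≡ a` if `ℓ ∣ a + jc` (Shimura 1971 Prop. 3.36; Cremona §2.4).
[cite: CremonaAlgorithms1997, §2.4] -/
theorem exists_gamma0_tpB_col {ℓ : ℕ} (hℓ : ℓ.Prime) (γ : Gamma0 N) (j : ℤ) :
    ∃ δ : Gamma0 N, ((δ : SL(2, ℤ)) 1 0 = 0 ↔ (γ : SL(2, ℤ)) 1 0 = 0) ∧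
      ((γ : SL(2, ℤ)) 1 0 ≠ 0 → ((δ : SL(2, ℤ)) 0 0 : ℚ) / ((δ : SL(2, ℤ)) 1 0 : ℚ) =
        (((γ : SL(2, ℤ)) 0 0 : ℚ) / ((γ : SL(2, ℤ)) 1 0 : ℚ) + j) / ℓ) ∧
      (¬ (ℓ : ℤ) ∣ (γ : SL(2, ℤ)) 0 0 + j * (γ : SL(2, ℤ)) 1 0 →
        (((δ : SL(2, ℤ)) 0 0 : ℤ) : ZMod N) = (((γ : SL(2, ℤ)) 0 0 : ℤ) : ZMod N)) ∧
      ((ℓ : ℤ) ∣ (γ : SL(2, ℤ)) 0 0 + j * (γ : SL(2, ℤ)) 1 0 →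
        (ℓ : ZMod N) * (((δ : SL(2, ℤ)) 0 0 : ℤ) : ZMod N) = (((γ : SL(2, ℤ)) 0 0 : ℤ) : ZMod N)) := by
  have hℓ0 : ℓ ≠ 0 := hℓ.ne_zero
  have hℓP : Prime (ℓ : ℤ) := Nat.prime_iff_prime_int.mp hℓ
  set a : ℤ := (γ : SL(2, ℤ)) 0 0 with ha_def
  set c : ℤ := (γ : SL(2, ℤ)) 1 0 with hc_def
  have hac : IsCoprime a c := Matrix.SpecialLinearGroup.isCoprime_col (γ : SL(2, ℤ)) 0
  have hNc : (N : ℤ) ∣ c := dvd_entry_of_mem_Gamma0 N γ.2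
  have hcN : ((c : ℤ) : ZMod N) = 0 := (ZMod.intCast_zmod_eq_zero_iff_dvd c N).mpr hNc
  have hajc : IsCoprime (a + j * c) c := by
    simpa [mul_comm] using hac.add_mul_right_left j
  by_cases hdvd : (ℓ : ℤ) ∣ a + j * c
  · obtain ⟨u, hu⟩ := hdvd
    have huc : IsCoprime u c := by
      rw [hu, mul_comm] at hajc
      exact hajc.of_mul_left_left
    refine ⟨Gamma0.mkOfCol u c huc hNc, by simp [c], fun hc ↦ ?_, fun h ↦ absurd ⟨u, hu⟩ h, fun _ ↦ ?_⟩
    · simp only [Gamma0.mkOfCol_apply_zero_zero, Gamma0.mkOfCol_apply_one_zero]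
      have hc' : (c : ℚ) ≠ 0 := by exact_mod_cast hc
      have hℓ' : (ℓ : ℚ) ≠ 0 := by exact_mod_cast hℓ0
      have hu' : (a : ℚ) + j * c = ℓ * u := by exact_mod_cast hu
      field_simp
      linear_combination -hu'
    · simp only [Gamma0.mkOfCol_apply_zero_zero]
      have h := congrArg (fun x : ℤ ↦ (x : ZMod N)) hu
      simp only [Int.cast_add, Int.cast_mul, Int.cast_natCast, hcN, mul_zero, add_zero] at h
      exact h.symm
  · have hℓc : IsCoprime (a + j * c) (ℓ * c) :=
      ((hℓP.coprime_iff_not_dvd.mpr hdvd).symm).mul_right hajc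
    refine ⟨Gamma0.mkOfCol (a + j * c) (ℓ * c) hℓc (hNc.mul_left _), by simp [c, hℓ0], fun hc ↦ ?_,
      fun _ ↦ ?_, fun h ↦ absurd h hdvd⟩
    · simp only [Gamma0.mkOfCol_apply_zero_zero, Gamma0.mkOfCol_apply_one_zero]
      have hc' : (c : ℚ) ≠ 0 := by exact_mod_cast hc
      have hℓ' : (ℓ : ℚ) ≠ 0 := by exact_mod_cast hℓ0
      push_cast
      field_simp
    · simp only [Gamma0.mkOfCol_apply_zero_zero, Int.cast_add, Int.cast_mul, hcN, mul_zero, add_zero]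

omit [NeZero N] f in
/-- **The cusp `diag(ℓ,1)γ∞ = ℓ·γ∞` with its `Γ₀(N)/Γ₁(N)`-class** (`ℓ ∤ N` prime): there is `δ ∈ Γ₀(N)` with `δ∞ = ℓa/c`
whose top-left entry is `a` if `ℓ ∣ c` (column `(a, c/ℓ)`) and `ℓa` otherwise (column `(ℓa, c)`).
[cite: CremonaAlgorithms1997, §2.4] -/
theorem exists_gamma0_tpD_col {ℓ : ℕ} (hℓ : ℓ.Prime) (hℓN : ¬ ℓ ∣ N) (γ : Gamma0 N) :
    ∃ δ : Gamma0 N, ((δ : SL(2, ℤ)) 1 0 = 0 ↔ (γ : SL(2, ℤ)) 1 0 = 0) ∧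
      ((γ : SL(2, ℤ)) 1 0 ≠ 0 → ((δ : SL(2, ℤ)) 0 0 : ℚ) / ((δ : SL(2, ℤ)) 1 0 : ℚ) =
        ℓ * (((γ : SL(2, ℤ)) 0 0 : ℚ) / ((γ : SL(2, ℤ)) 1 0 : ℚ))) ∧
      ((ℓ : ℤ) ∣ (γ : SL(2, ℤ)) 1 0 → (((δ : SL(2, ℤ)) 0 0 : ℤ) : ZMod N) = (((γ : SL(2, ℤ)) 0 0 : ℤ) : ZMod N)) ∧
      (¬ (ℓ : ℤ) ∣ (γ : SL(2, ℤ)) 1 0 →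
        (((δ : SL(2, ℤ)) 0 0 : ℤ) : ZMod N) = (ℓ : ZMod N) * (((γ : SL(2, ℤ)) 0 0 : ℤ) : ZMod N)) := by
  have hℓ0 : ℓ ≠ 0 := hℓ.ne_zero
  have hℓP : Prime (ℓ : ℤ) := Nat.prime_iff_prime_int.mp hℓ
  set a : ℤ := (γ : SL(2, ℤ)) 0 0 with ha_def
  set c : ℤ := (γ : SL(2, ℤ)) 1 0 with hc_def
  have hac : IsCoprime a c := Matrix.SpecialLinearGroup.isCoprime_col (γ : SL(2, ℤ)) 0
  have hNc : (N : ℤ) ∣ c := dvd_entry_of_mem_Gamma0 N γ.2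
  by_cases hdvd : (ℓ : ℤ) ∣ c
  · obtain ⟨v, hv⟩ := hdvd
    have hav : IsCoprime a v := by
      rw [hv] at hac
      exact hac.of_mul_right_right
    have hNℓ : IsCoprime (N : ℤ) ℓ := by
      rw [Nat.isCoprime_iff_coprime]
      exact (Nat.Coprime.symm ((Nat.Prime.coprime_iff_not_dvd hℓ).mpr hℓN))
    have hNv : (N : ℤ) ∣ v := hNℓ.dvd_of_dvd_mul_left (by rw [← hv]; exact hNc)
    refine ⟨Gamma0.mkOfCol a v hav hNv, by simp [c, hv, hℓ0], fun hc ↦ ?_, fun _ ↦ by simp, fun h ↦ absurd ⟨v, hv⟩ h⟩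
    simp only [Gamma0.mkOfCol_apply_zero_zero, Gamma0.mkOfCol_apply_one_zero]
    have hv0 : v ≠ 0 := by
      rintro rfl
      exact hc (by simpa [c] using hv)
    have hv' : (v : ℚ) ≠ 0 := by exact_mod_cast hv0
    have hℓ' : (ℓ : ℚ) ≠ 0 := by exact_mod_cast hℓ0
    have hcv : (c : ℚ) = ℓ * v := by exact_mod_cast hv
    rw [hcv]
    field_simp
  · have hℓc : IsCoprime (ℓ * a) c := (hℓP.coprime_iff_not_dvd.mpr hdvd).mul_left hac
    refine ⟨Gamma0.mkOfCol (ℓ * a) c hℓc hNc, by simp [c], fun hc ↦ ?_, fun h ↦ absurd h hdvd, fun _ ↦ ?_⟩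
    · simp only [Gamma0.mkOfCol_apply_zero_zero, Gamma0.mkOfCol_apply_one_zero]
      push_cast
      ring
    · simp only [Gamma0.mkOfCol_apply_zero_zero, Int.cast_mul, Int.cast_natCast]

/-! ### The unique `j mod ℓ` with `ℓ ∣ a + jc` -/

omit [NeZero N] f in
/-- For `ℓ` prime, `ℓ ∤ c`: there is exactly one `j ∈ [0, ℓ)` with `ℓ ∣ a + jc` — existence. [folklore] -/
private theorem exists_fin_dvd_add_mul {ℓ : ℕ} (hℓ : ℓ.Prime) {a c : ℤ} (hc : ¬ (ℓ : ℤ) ∣ c) :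
    ∃ j₀ : Fin ℓ, (ℓ : ℤ) ∣ a + ((j₀ : ℕ) : ℤ) * c := by
  haveI : Fact ℓ.Prime := ⟨hℓ⟩
  have hcℓ : ((c : ℤ) : ZMod ℓ) ≠ 0 := by
    rwa [Ne, ZMod.intCast_zmod_eq_zero_iff_dvd]
  set x : ZMod ℓ := -(a : ZMod ℓ) * ((c : ℤ) : ZMod ℓ)⁻¹ with hx
  refine ⟨⟨x.val, x.val_lt⟩, ?_⟩
  rw [← ZMod.intCast_zmod_eq_zero_iff_dvd]
  push_cast
  rw [ZMod.natCast_zmod_val, hx]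
  field_simp
  ring

omit [NeZero N] f in
/-- … and uniqueness: two `j, j' ∈ [0, ℓ)` with `ℓ ∣ a + jc`, `ℓ ∣ a + j'c`, `ℓ ∤ c`, are equal. [folklore] -/
private theorem fin_eq_of_dvd_add_mul {ℓ : ℕ} (hℓ : ℓ.Prime) {a c : ℤ} (hc : ¬ (ℓ : ℤ) ∣ c) {j j' : Fin ℓ}
    (hj : (ℓ : ℤ) ∣ a + ((j : ℕ) : ℤ) * c) (hj' : (ℓ : ℤ) ∣ a + ((j' : ℕ) : ℤ) * c) : j = j' := by
  haveI : Fact ℓ.Prime := ⟨hℓ⟩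
  have hℓP : Prime (ℓ : ℤ) := Nat.prime_iff_prime_int.mp hℓ
  have hsub : (ℓ : ℤ) ∣ (((j : ℕ) : ℤ) - ((j' : ℕ) : ℤ)) * c := by
    have h := dvd_sub hj hj'
    have e : a + ((j : ℕ) : ℤ) * c - (a + ((j' : ℕ) : ℤ) * c) = (((j : ℕ) : ℤ) - ((j' : ℕ) : ℤ)) * c := by ring
    rwa [e] at h
  have hjj : (ℓ : ℤ) ∣ ((j : ℕ) : ℤ) - ((j' : ℕ) : ℤ) := (hℓP.dvd_or_dvd hsub).resolve_right hc
  have hmod : ((j : ℕ) : ZMod ℓ) = ((j' : ℕ) : ZMod ℓ) := by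
    have h := (ZMod.intCast_zmod_eq_zero_iff_dvd _ ℓ).mpr hjj
    push_cast at h
    exact sub_eq_zero.mp h
  rw [ZMod.natCast_eq_natCast_iff, Nat.ModEq, Nat.mod_eq_of_lt j.isLt, Nat.mod_eq_of_lt j'.isLt] at hmod
  exact Fin.ext hmod

/-! ### THEOREM W away from the level: `(a − ℓ − 1)·{∞, γ∞}_f ∈ Λ₁(f)` -/

/-- **`(a − ℓ − 1)·{∞, γ∞}_f ∈ Λ₁(f)`** for `T_ℓ f = a f`, `ℓ ∤ N` prime, `γ ∈ Γ₀(N)`: the Shimura quotient is Eisenstein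
(`T_ℓ = ℓ + 1` on `Σ(N)`, Ribet).  See the module docstring for the coset bookkeeping.
[cite: Ribet1988Shimura, Thm. 1 and §3 («Σ is Eisenstein»); period-lattice form for an arbitrary T_ℓ-eigenform proved here]
[cite: CremonaAlgorithms1997, §2.4 (2.4.1)–(2.4.2)] -/
theorem sub_sub_mul_cuspSymbol_mem_periodLatticeGamma1_of_not_dvd {ℓ : ℕ} [NeZero ℓ] (hℓ : ℓ.Prime) (hℓN : ¬ ℓ ∣ N)
    {a : ℂ} (hT : heckeT (Gamma0 N) 2 ℓ f = a • f) (γ : Gamma0 N) :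
    (a - ℓ - 1) * cuspSymbol f γ ∈ periodLatticeGamma1 f := by
  by_cases hc : (γ : SL(2, ℤ)) 1 0 = 0
  · rw [cuspSymbol, if_pos hc, mul_zero]; exact zero_mem _
  have hℓ0 : (ℓ : ℚ) ≠ 0 := by exact_mod_cast hℓ.ne_zero
  -- the Hecke cusps as Γ₀(N)-translates of ∞, with their classes
  choose δ hδc hδv hδa hδa' using fun j : Fin ℓ ↦ exists_gamma0_tpB_col (N := N) hℓ γ ((j : ℕ) : ℤ)
  obtain ⟨δD, hDc, hDv, hDa, hDa'⟩ := exists_gamma0_tpD_col (N := N) hℓ hℓN γ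
  -- an element of class `ℓ`
  have hℓu : IsUnit (ℓ : ZMod N) := by
    rw [← ZMod.coe_unitOfCoprime ℓ ((Nat.Prime.coprime_iff_not_dvd hℓ).mpr hℓN)]
    exact Units.isUnit _
  obtain ⟨κ, hκ⟩ := exists_gamma0_apply_one_one_eq_of_isUnit hℓu
  -- `a {∞, γ∞}_f = ∑ⱼ {∞, δⱼ∞}_f + {∞, δ_D ∞}_f`
  have hTa : a * cuspSymbol f γ = ∑ j : Fin ℓ, cuspSymbol f (δ j) + cuspSymbol f δD := by
    rw [← cuspSymbol_smul, ← hT, cuspSymbol, if_neg hc, modularSymbol_heckeT_eq_sum ℓ f hℓ, if_neg hℓN]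
    congr 1
    · refine Finset.sum_congr rfl fun j _ ↦ ?_
      have hδjc : (δ j : SL(2, ℤ)) 1 0 ≠ 0 := fun h ↦ hc ((hδc j).mp h)
      rw [cuspSymbol, if_neg hδjc, hδv j hc]
    · have hDc' : (δD : SL(2, ℤ)) 1 0 ≠ 0 := fun h ↦ hc (hDc.mp h)
      rw [cuspSymbol, if_neg hDc', hDv hc]
  set s := cuspSymbol f γ with hs
  set t := cuspSymbol f κ with ht
  by_cases hℓc : (ℓ : ℤ) ∣ (γ : SL(2, ℤ)) 1 0
  · -- `ℓ ∣ c`: every Hecke cusp has the class of `γ`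
    have hj : ∀ j : Fin ℓ, cuspSymbol f (δ j) - s ∈ periodLatticeGamma1 f := by
      intro j
      refine cuspSymbol_sub_mem_periodLatticeGamma1_of_apply_zero_zero_eq f γ (δ j) (hδa j fun h ↦ ?_)
      -- `ℓ ∣ a + jc` with `ℓ ∣ c` would give `ℓ ∣ a`, contradicting `gcd(a, c) = 1`
      have hℓa : (ℓ : ℤ) ∣ (γ : SL(2, ℤ)) 0 0 := by
        have := dvd_sub h (hℓc.mul_left ((j : ℕ) : ℤ))
        simpa using this
      have hcop : IsCoprime ((γ : SL(2, ℤ)) 0 0) ((γ : SL(2, ℤ)) 1 0) :=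
        Matrix.SpecialLinearGroup.isCoprime_col (γ : SL(2, ℤ)) 0
      exact (Nat.prime_iff_prime_int.mp hℓ).not_unit (hcop.isUnit_of_dvd' hℓa hℓc)
    have hD : cuspSymbol f δD - s ∈ periodLatticeGamma1 f :=
      cuspSymbol_sub_mem_periodLatticeGamma1_of_apply_zero_zero_eq f γ δD (hDa hℓc)
    have hkey : (a - ℓ - 1) * s = ∑ j : Fin ℓ, (cuspSymbol f (δ j) - s) + (cuspSymbol f δD - s) := by
      rw [Finset.sum_sub_distrib, Finset.sum_const, Finset.card_univ, Fintype.card_fin, nsmul_eq_mul, sub_mul,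
        sub_mul, hTa]
      ring
    rw [hkey]
    exact add_mem (sum_mem fun j _ ↦ hj j) hD
  · -- `ℓ ∤ c`: one exceptional `j₀` (class `ℓ⁻¹·γ`) and the last cusp (class `ℓ·γ`) compensate
    obtain ⟨j₀, hj₀⟩ := exists_fin_dvd_add_mul hℓ (a := (γ : SL(2, ℤ)) 0 0) hℓc
    have hj : ∀ j : Fin ℓ, j ≠ j₀ → cuspSymbol f (δ j) - s ∈ periodLatticeGamma1 f := by
      intro j hne
      refine cuspSymbol_sub_mem_periodLatticeGamma1_of_apply_zero_zero_eq f γ (δ j) (hδa j fun h ↦ ?_)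
      exact hne (fin_eq_of_dvd_add_mul hℓ hℓc h hj₀)
    have hj₀' : cuspSymbol f (δ j₀) - s - t ∈ periodLatticeGamma1 f :=
      cuspSymbol_sub_sub_mem_periodLatticeGamma1_of_mul_apply_zero_zero_eq f γ (δ j₀) κ hκ (hδa' j₀ hj₀)
    have hD : cuspSymbol f δD - s + t ∈ periodLatticeGamma1 f :=
      cuspSymbol_sub_add_mem_periodLatticeGamma1_of_apply_zero_zero_eq_mul f γ δD κ hκ (hDa' hℓc)
    have hsum : ∑ j : Fin ℓ, (cuspSymbol f (δ j) - s) =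
        (cuspSymbol f (δ j₀) - s) + ∑ j ∈ Finset.univ.erase j₀, (cuspSymbol f (δ j) - s) :=
      (Finset.add_sum_erase _ _ (Finset.mem_univ j₀)).symm
    have hkey : (a - ℓ - 1) * s =
        ((cuspSymbol f (δ j₀) - s - t) + ∑ j ∈ Finset.univ.erase j₀, (cuspSymbol f (δ j) - s)) +
          (cuspSymbol f δD - s + t) := by
      have h1 : (a - ℓ - 1) * s = ∑ j : Fin ℓ, (cuspSymbol f (δ j) - s) + (cuspSymbol f δD - s) := by
        rw [Finset.sum_sub_distrib, Finset.sum_const, Finset.card_univ, Fintype.card_fin, nsmul_eq_mul, sub_mul,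
          sub_mul, hTa]
        ring
      rw [h1, hsum]
      ring
    rw [hkey]
    refine add_mem (add_mem hj₀' (sum_mem fun j hjm ↦ hj j (Finset.ne_of_mem_erase hjm))) hD

/-- **`(a − ℓ − 1) Λ₀(f) ⊆ Λ₁(f)`** for `T_ℓ f = a f`, `ℓ ∤ N` prime (THEOREM W away from the level; Ribet: `Σ(N)` is
Eisenstein). [cite: Ribet1988Shimura, Thm. 1 and §3; period-lattice form proved here] [cite: LingOesterle1991, §1] -/
theorem heckeEigenPeriodCongruence_of_not_dvd {ℓ : ℕ} [NeZero ℓ] (hℓ : ℓ.Prime) (hℓN : ¬ ℓ ∣ N) {a : ℂ}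
    (hT : heckeT (Gamma0 N) 2 ℓ f = a • f) {z : ℂ} (hz : z ∈ periodLattice f) :
    (a - ℓ - 1) * z ∈ periodLatticeGamma1 f := by
  have hz' : z ∈ AddSubgroup.closure (Set.range (cuspSymbol f)) := hz
  refine AddSubgroup.closure_induction (fun x hx ↦ ?_) ?_ (fun x y _ _ hx hy ↦ ?_) (fun x _ hx ↦ ?_) hz'
  · obtain ⟨γ, rfl⟩ := hx
    exact sub_sub_mul_cuspSymbol_mem_periodLatticeGamma1_of_not_dvd f hℓ hℓN hT γ
  · rw [mul_zero]; exact zero_mem _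
  · rw [mul_add]; exact add_mem hx hy
  · rw [mul_neg]; exact neg_mem hx

/-- **Newform version**: for a newform `f ∈ S₂(Γ₀(N))` and a prime `ℓ ∤ N`, `(a_ℓ(f) − ℓ − 1) Λ₀(f) ⊆ Λ₁(f)` — the Shimura
quotient `Λ₀(f)/Λ₁(f)` is killed by the Eisenstein numbers `a_ℓ − ℓ − 1`.
[cite: Ribet1988Shimura, Thm. 1 and §3; period-lattice form proved here] [cite: DiamondShurman2005, Prop. 5.8.5] -/
theorem sub_sub_mul_mem_periodLatticeGamma1_of_isNewform0 (hf : IsNewform0 f) {ℓ : ℕ} [NeZero ℓ] (hℓ : ℓ.Prime)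
    (hℓN : ¬ ℓ ∣ N) {z : ℂ} (hz : z ∈ periodLattice f) :
    (cuspCoeff f ℓ - ℓ - 1) * z ∈ periodLatticeGamma1 f :=
  heckeEigenPeriodCongruence_of_not_dvd f hℓ hℓN (hf.heckeT_eq_coeff_smul hℓ) hz

/-- **Coprime-killer form**: if `m Λ₀(f) ⊆ Λ₁(f)` for an integer `m` coprime to the integer `a_ℓ − ℓ − 1` (`T_ℓ f = a_ℓ f`,
`ℓ ∤ N`, `a_ℓ ∈ ℤ`), then `Λ₁(f) = Λ₀(f)` (Bézout). E.g. `m = p` a traceless prime with `p ∤ a_ℓ − ℓ − 1`.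
[cite: Ribet1988Shimura, Thm. 1 and §3; corollary proved here] -/
theorem periodLatticeGamma1_eq_of_coprime {ℓ : ℕ} [NeZero ℓ] (hℓ : ℓ.Prime) (hℓN : ¬ ℓ ∣ N) {aℓ : ℤ}
    (hT : heckeT (Gamma0 N) 2 ℓ f = (aℓ : ℂ) • f) {m : ℤ} (hm : ∀ z ∈ periodLattice f, (m : ℂ) * z ∈ periodLatticeGamma1 f)
    (hcop : IsCoprime m (aℓ - ℓ - 1)) : periodLatticeGamma1 f = periodLattice f := by
  refine le_antisymm (periodLatticeGamma1_le_periodLattice f) fun z hz ↦ ?_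
  obtain ⟨u, v, huv⟩ := hcop
  have h1 := hm z hz
  have h2 : ((aℓ - ℓ - 1 : ℤ) : ℂ) * z ∈ periodLatticeGamma1 f := by
    have h := heckeEigenPeriodCongruence_of_not_dvd f hℓ hℓN hT hz
    push_cast at h ⊢
    exact h
  have hu : (u : ℂ) * ((m : ℂ) * z) ∈ periodLatticeGamma1 f := by
    rw [← zsmul_eq_mul]; exact (periodLatticeGamma1 f).zsmul_mem h1 u
  have hv : (v : ℂ) * (((aℓ - ℓ - 1 : ℤ) : ℂ) * z) ∈ periodLatticeGamma1 f := by
    rw [← zsmul_eq_mul]; exact (periodLatticeGamma1 f).zsmul_mem h2 v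
  have e : z = (u : ℂ) * ((m : ℂ) * z) + (v : ℂ) * (((aℓ - ℓ - 1 : ℤ) : ℂ) * z) := by
    have h := congrArg (fun x : ℤ ↦ (x : ℂ)) huv
    push_cast at h ⊢
    linear_combination -z * h
  rw [e]
  exact add_mem hu hv

end Literature.NumberTheory.EllipticCurves.ModularForms

end
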